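import Summits.Ventures.DiscreteObjects.UnitDistance.QuadraticPlanesFourI
import Summits.Ventures.DiscreteObjects.UnitDistance.PlaneSqrt251Four
import HarnessLib

/-!
# Quadratic planes with chromatic number four, X: `d = 251` by distance-two forcing; the ledger of open rows below `400`
(cell `pub-namedobj`, target (U), seat udg g27 — summary)

Framing (verbatim for the cell): lottery ticket; floor = certified bounds/negative ranges.

One more row of the quadratic table is exact: `χ(ℚ(√251)²) = 4` (`PlaneSqrt251Four.lean`).  What changed (udg g27): no 4-chromatic finite
witness is used.  A 121-vertex unit-distance graph `G₂₅₁ ⊂ ℚ(√251)²` (denominator `130`) is 3-colourable but forces DIFFERENT colours on its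
vertices `(−1,0)` and `(1,0)` in every proper 3-colouring (kernel search, `PlaneSqrt251GadgetSearch.lean`); the `K`-rational isometries transport
this to every pair at distance `2`, and for `d = 12k − 1` a proper 3-colouring of `ℚ(√d)²` with all distance-`2` pairs bichromatic cannot
exist (`DistanceTwoForcing.lean`: period `3` along unit lines, `(1,0) = 2k·(3,0) − k·3s − k·3s̄` with the unit vector `s = ((6k−1)/(6k), √d/(6k))`).
Diagnosis behind it: the decided rows have unit pentagons at small height, the open ones odd girth `≥ 7` in every coherent world, so the cell's
radius-3/4 balls could not contain a witness; a forced pair appears one radius before non-3-colourability (calibration `d = 11`).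

CONSEQUENCES.  `chromaticNumber_plane_multiSqrtField_eq_four_eighteen`: eighteen exact rows with value four are now in the tree.
`quadratic_open_rows_lt_400'''`: the fourteen rows below `400` that are still not exact — `{3, 4}` for `83, 107, 227, 323, 347, 371, 395`;
`{4, 5}` for `47, 143, 311, 335`; `[3, 5]` for `215, 383`; `[3, 7]` for `167`.  Values `≥ 4` not found in print (PROVISIONAL).
-/

noncomputable section

namespace Summit.Ventures.DiscreteObjects.UnitDistance

open SimpleGraph IntermediateField
open scoped IntermediateField

/-- The eighteen exact rows with value four now in the tree (`11, 23, 35, 59, 71, 95, 119, 131, 179, 191` of udg g12–g14; `239, 359` of udg g15;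
`155, 203, 263` of udg g16; `287, 299` of udg g18; `251` of udg g27, by distance-two forcing), atlas vocabulary. -/
theorem chromaticNumber_plane_multiSqrtField_eq_four_eighteen :
    ∀ d ∈ ({11, 23, 35, 59, 71, 95, 119, 131, 155, 179, 191, 203, 239, 251, 263, 287, 299, 359} : Finset ℕ),
      (planeUnitDistanceGraph.induce (fieldPoints (multiSqrtField {d}))).chromaticNumber = 4 := by
  intro d hd
  simp only [Finset.mem_insert, Finset.mem_singleton] at hd
  rcases hd with rfl | rfl | rfl | rfl | rfl | rfl | rfl | rfl | rfl | rfl | rfl | rfl | rfl | rfl | rfl | rfl | rfl | rfl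
  · exact chromaticNumber_plane_multiSqrtField_11
  · exact chromaticNumber_plane_multiSqrtField_23
  · exact chromaticNumber_plane_multiSqrtField_35
  · exact chromaticNumber_plane_multiSqrtField_59
  · exact chromaticNumber_plane_multiSqrtField_71
  · exact chromaticNumber_plane_multiSqrtField_95
  · exact chromaticNumber_plane_multiSqrtField_119
  · exact chromaticNumber_plane_multiSqrtField_131
  · exact chromaticNumber_plane_multiSqrtField_155
  · exact chromaticNumber_plane_multiSqrtField_179
  · exact chromaticNumber_plane_multiSqrtField_191
  · exact chromaticNumber_plane_multiSqrtField_203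
  · exact chromaticNumber_plane_multiSqrtField_239
  · exact chromaticNumber_plane_multiSqrtField_251
  · exact chromaticNumber_plane_multiSqrtField_263
  · exact chromaticNumber_plane_multiSqrtField_287
  · exact chromaticNumber_plane_multiSqrtField_299
  · exact chromaticNumber_plane_multiSqrtField_359

/-- THE OPEN ROWS BELOW `400`, AMENDED (fourteen values; `251` is exact since this file): `3 ≤ χ ≤ 4` for `83, 107, 227, 323, 347, 371, 395`;
`4 ≤ χ ≤ 5` for `47, 143, 311, 335`; `3 ≤ χ ≤ 5` for `215, 383`; `3 ≤ χ ≤ 7` for `167`.  Every other square-free `d ≡ 3 (mod 4)` below `400` has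
`χ(ℚ(√d)²) = 3` (`d ≢ 2 (mod 3)`) or `= 4` (the eighteen of `chromaticNumber_plane_multiSqrtField_eq_four_eighteen`). -/
theorem quadratic_open_rows_lt_400''' :
    (∀ d ∈ ({83, 107, 227, 323, 347, 371, 395} : Finset ℕ),
        ¬ (planeUnitDistanceGraph.induce (fieldPoints (multiSqrtField {d}))).Colorable 2 ∧
          (planeUnitDistanceGraph.induce (fieldPoints (multiSqrtField {d}))).Colorable 4) ∧
    (∀ d ∈ ({47, 143, 311, 335} : Finset ℕ),
        4 ≤ (planeUnitDistanceGraph.induce (fieldPoints (multiSqrtField {d}))).chromaticNumber ∧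
          (planeUnitDistanceGraph.induce (fieldPoints (multiSqrtField {d}))).chromaticNumber ≤ 5) ∧
    (∀ d ∈ ({215, 383} : Finset ℕ),
        ¬ (planeUnitDistanceGraph.induce (fieldPoints (multiSqrtField {d}))).Colorable 2 ∧
          (planeUnitDistanceGraph.induce (fieldPoints (multiSqrtField {d}))).Colorable 5) ∧
    (¬ (planeUnitDistanceGraph.induce (fieldPoints (multiSqrtField {167}))).Colorable 2 ∧
      (planeUnitDistanceGraph.induce (fieldPoints (multiSqrtField {167}))).chromaticNumber ≤ 7) := by
  obtain ⟨h34, h45, h35, h167⟩ := quadratic_open_rows_lt_400''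
  refine ⟨?_, h45, h35, h167⟩
  intro d hd
  simp only [Finset.mem_insert, Finset.mem_singleton] at hd
  rcases hd with rfl | rfl | rfl | rfl | rfl | rfl | rfl <;> exact h34 _ (by decide)

end Summit.Ventures.DiscreteObjects.UnitDistance
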